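import Mathlib
import HarnessLib
import Summits.ABC.ABC.Theses.CongruentialReceptacle
import Literature.NumberTheory.EllipticCurves.SzpiroSixFifthsProofs

/-!
# The bounded-`j` dictionary of the crux `CompactBalanceTransfer` (stmt-ABC-1725)

Support file (`--supports stmt-ABC-1725`) of the line lead c9 of crux stmt-ABC-1725
(`prover-line-stmt-ABC-1725-c9-0`, 2026-08-17, line `birth`). The crux is `H → ABC` with
`H := ∀ κ > 0, ∀ ε > 0, ∃ C, ∀ abc-triples, κc ≤ a → κc ≤ b → c < C·rad(abc)^(1+ε)` — abc on every COMPACTLY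
BALANCED cell. The route's Target prose ("on this cell `log⁺|j_E| = O_κ(1)`"), the informal statement of the crux
("the over-ℚ shadow of MochizukiGenEll2010 Thm 2.1: abc for compactly bounded subsets ⟹ abc") and the
crux-strategist's route move R3 (`Cruxes/CompactBalanceTransfer/STRATEGY-CENSUS.md` §6.2: re-aim the Target at
bounded-`j` Szpiro `BJ`) all rest on one dictionary, so far prose only; this file makes it kernel-checked:

* `exists_minimal_frey_model_j` — every abc-triple carries a global minimal Frey model `W₀/ℤ` (B–G 12.5.10) with
  `cond ∣ 2¹⁰·rad(abc)`, `(abc)² ≤ 2⁸|Δ(W₀)|` AND `j(W₀ ⊗ ℚ) = 2⁸(a²+ab+b²)³/(abc)²` (`freyCurve_j`: the same value for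
  the Frey curve `y² = x(x−a)(x+b)` itself);
* `abs_freyJ_le_of_balanced` — `κc ≤ a, κc ≤ b ⟹ |j| ≤ 2⁸/κ⁴`; `balanced_of_abs_freyJ_le` — `|j| ≤ J ⟹ √(108/J)·c ≤ a, b`
  (compactly balanced in `P¹∖{0,1,∞}` = compactly bounded in `X(1)` at the archimedean place, BOTH directions);
* `balancedABC_iff_boundedJ` — `H ↔ (∀ J, abc with exponent 1+ε on the Frey fibres with |j| ≤ J)`: the crux is
  LITERALLY "abc on every compactly bounded (at ∞) family of Frey fibres ⟹ abc", the degree-1 shadow of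
  MochizukiGenEll2010 Thm 2.1;
* `balancedABC_of_boundedJSzpiro` — bounded-`j` Szpiro `BJ := ∀ J ε, |Δ_min(E)| ≤ C(J,ε)·N(E)^(6+ε) for all E/ℚ
  with |j(E)| ≤ J` (the strategist's typed `BoundedJSzpiro`, written out) implies `H`;
  `boundedJSzpiro_of_szpiro` — `SzpiroConjecture → BJ`;
* `abc_of_boundedJSzpiro_of_compactBalanceTransfer` — `CompactBalanceTransfer → BJ → ABC`: the crux is at least the
  H-free partner `BJ → ABC` of R3, which in turn is at least `SzpiroConjecture → ABC` (composing with
  `boundedJSzpiro_of_szpiro` recovers `Negative.abc_of_szpiro_of_compactBalanceTransfer`, p97877, so it is not restated).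

No new definitions; `BJ` and the bounded-`j` Frey hypothesis are spelled out in the signatures.
-/

-- `Summit.<Summit>.<Problem>`: for the single-conjunct summit `ABC` the duplicate `ABC.ABC` is mandated.
set_option linter.dupNamespace false

namespace Summit.ABC.ABC.Theorems.CompactBalanceTransfer.BoundedJ

open Literature.NumberTheory.DiophantineGeometry
open Literature.NumberTheory.EllipticCurves
open Summit.ABC.ABC.Theses.CongruentialReceptacle

/-! ## The `j`-invariant of the Frey models

Over a field `j = c₄³/Δ` (`WeierstrassCurve.j` unfolded in place: `j = Δ'⁻¹·c₄³`); `c₄(freyCurve a b) = 16(a²+ab+b²)` is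
`Literature.NumberTheory.EllipticCurves.freyCurve_c₄` (DegreeConjectureAbcMurtyProofs), recomputed inline here to keep the
imports light. -/

/-- **The `j`-invariant of the Frey curve** `y² = x(x−a)(x+b)`, `ab(a+b) ≠ 0`:
`j = 2⁸(a² + ab + b²)³/(ab(a+b))²` (the Legendre-form value `2⁸(λ²−λ+1)³/(λ²(λ−1)²)` at `λ = a/(a+b)`).
[folklore] -/
theorem freyCurve_j (a b : ℤ) [(freyCurve a b).IsElliptic] (h : a * b * (a + b) ≠ 0) :
    (freyCurve a b).j = 2 ^ 8 * ((a : ℚ) ^ 2 + a * b + b ^ 2) ^ 3 / ((a : ℚ) * b * (a + b)) ^ 2 := by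
  have h' : ((a : ℚ) * b * (a + b)) ≠ 0 := by exact_mod_cast h
  have hc₄ : (freyCurve a b).c₄ = 16 * ((a : ℚ) ^ 2 + a * b + b ^ 2) := by
    simp only [WeierstrassCurve.c₄, WeierstrassCurve.b₂, WeierstrassCurve.b₄, freyCurve_a₁, freyCurve_a₂,
      freyCurve_a₃, freyCurve_a₄]
    ring
  rw [WeierstrassCurve.j, Units.val_inv_eq_inv_val, WeierstrassCurve.coe_Δ', ← div_eq_inv_mul, hc₄, freyCurve_Δ]
  field_simp
  ring

/-- **B–G 12.5.10 packaged with the `j`-INVARIANT clause.** Every abc triple carries a global minimal Frey model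
`W₀` over `ℤ` — (12.17) for `(a, b)` if `16 ∤ abc`, (12.18) for the arrangement of `exists_arrangement` if `16 ∣ abc` —
with `cond ∣ 2¹⁰·rad(abc)`, `(abc)² ≤ 2⁸|Δ(W₀)|`, and `j(W₀ ⊗ ℚ) = 2⁸(a² + ab + b²)³/(abc)²` (the `j`-invariant does not
see the arrangement: `A² + AB + B² = a² + ab + b²` and `(AB(A+B))² = (abc)²`). [cite: BombieriGubler2006, Ex. 12.5.10] -/
theorem exists_minimal_frey_model_j {a b c : ℕ} (h : IsABCTriple a b c) :
    ∃ W₀ : WeierstrassCurve ℤ, ∃ _ : (W₀.baseChange ℚ).IsElliptic,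
      (∀ v : IsDedekindDomain.HeightOneSpectrum ℤ, (W₀.baseChange ℚ).IsMinimalAt v) ∧
      (W₀.baseChange ℚ).conductorNorm ℤ ∣ 2 ^ 10 * rad a b c ∧
      ((a * b * c : ℕ) : ℤ) ^ 2 ≤ 2 ^ 8 * |W₀.Δ| ∧
      (W₀.baseChange ℚ).j = 2 ^ 8 * ((a : ℚ) ^ 2 + a * b + b ^ 2) ^ 3 / ((a : ℚ) * b * c) ^ 2 := by
  have h' := h
  obtain ⟨ha, hb, habc, hcop⟩ := h'
  have hc : 0 < c := by omega
  have habc0 : a * b * c ≠ 0 := by positivity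
  have habcQ : ((a : ℚ) * b * c) ≠ 0 := by exact_mod_cast habc0
  have hcq : (c : ℚ) = a + b := by exact_mod_cast habc.symm
  by_cases h16 : 16 ∣ a * b * c
  · obtain ⟨A, B, hAB, hA, hB, hprod, hquad⟩ := exists_arrangement h h16
    have h0 : A * B * (A + B) ≠ 0 := by
      rw [← Int.natAbs_ne_zero, hprod]; exact habc0
    have h4 : 4 ∣ B - A - 1 := by
      have : B - A - 1 = B - (A + 1) := by ring
      rw [this]; exact dvd_sub (dvd_trans (by norm_num) hB) hA
    have h16' : 16 ∣ A * B := dvd_mul_of_dvd_right hB _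
    haveI hE := isElliptic_freyIntModel₂ h0 h4 h16'
    refine ⟨freyIntModel₂ A B, hE, isMinimalAt_freyIntModel₂ hAB hA hB, ?_, ?_, ?_⟩
    · rw [rad_def, ← hprod]
      exact (conductorNorm_freyIntModel₂_dvd hAB h0 hA hB).trans (dvd_mul_left _ _)
    · rw [freyIntModel₂_Δ h4 h16']
      obtain ⟨e, he⟩ := h16'
      have he' : A * B / 16 = e := by rw [he]; simp
      have hcast : ((a * b * c : ℕ) : ℤ) ^ 2 = (A * B * (A + B)) ^ 2 := by
        rw [← hprod, Int.natCast_natAbs, sq_abs]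
      rw [hcast, he', show (A * B * (A + B)) ^ 2 = 2 ^ 8 * (e ^ 2 * (A + B) ^ 2) by rw [he]; ring,
        abs_of_nonneg (by positivity)]
    · -- the `j`-invariant of (12.18)
      obtain ⟨e, he⟩ := h16'
      have he' : A * B / 16 = e := by rw [he]; simp
      have hQ : A ^ 2 + A * B + B ^ 2 = (a : ℤ) ^ 2 + a * b + b ^ 2 := by
        have hq := hquad
        rw [← habc] at hq
        push_cast at hq
        linarith
      have hD : 2 ^ 8 * ((A * B / 16) ^ 2 * (A + B) ^ 2) = ((a : ℤ) * b * c) ^ 2 := by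
        have hcast : ((a : ℤ) * b * c) ^ 2 = (A * B * (A + B)) ^ 2 := by
          have : ((a * b * c : ℕ) : ℤ) = (a : ℤ) * b * c := by push_cast; ring
          rw [← this, ← hprod, Int.natCast_natAbs, sq_abs]
        rw [hcast, he', he]; ring
      have hDq : (((A * B / 16) ^ 2 * (A + B) ^ 2 : ℤ) : ℚ) = ((a : ℚ) * b * c) ^ 2 / 2 ^ 8 := by
        rw [eq_div_iff (by norm_num)]
        have := congrArg (fun z : ℤ => (z : ℚ)) hD
        push_cast at this ⊢
        linarith
      rw [WeierstrassCurve.j, Units.val_inv_eq_inv_val, WeierstrassCurve.coe_Δ', ← div_eq_inv_mul,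
        WeierstrassCurve.baseChange_int_c₄, WeierstrassCurve.baseChange_int_Δ,
        freyIntModel₂_c₄ h4 ⟨e, he⟩, freyIntModel₂_Δ h4 ⟨e, he⟩, hQ, hDq]
      push_cast
      field_simp
  · have hab : IsCoprime (a : ℤ) (b : ℤ) := Nat.isCoprime_iff_coprime.mpr hcop
    have hP : (a : ℤ) * b * (a + b) = ((a * b * c : ℕ) : ℤ) := by rw [← habc]; push_cast; ring
    have h0 : (a : ℤ) * b * (a + b) ≠ 0 := by rw [hP]; exact_mod_cast habc0
    have h16' : ¬ (16 : ℤ) ∣ (a : ℤ) * b * (a + b) := by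
      rw [hP]; exact_mod_cast mt Int.natCast_dvd_natCast.mp h16
    haveI hE := isElliptic_freyIntModel h0
    refine ⟨freyIntModel a b, hE, isMinimalAt_freyIntModel hab h0 h16', ?_, ?_, ?_⟩
    · have := conductorNorm_freyIntModel_dvd hab h0 h16'
      rwa [hP, Int.natAbs_natCast, ← rad_def] at this
    · rw [freyIntModel_Δ, hP, abs_of_nonneg (by positivity)]
      nlinarith [sq_nonneg (((a * b * c : ℕ) : ℤ))]
    · -- the `j`-invariant of (12.17)
      rw [WeierstrassCurve.j, Units.val_inv_eq_inv_val, WeierstrassCurve.coe_Δ', ← div_eq_inv_mul,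
        WeierstrassCurve.baseChange_int_c₄, WeierstrassCurve.baseChange_int_Δ,
        freyIntModel_c₄, freyIntModel_Δ]
      push_cast
      rw [← hcq]
      field_simp
      ring

/-! ## Compactly balanced ⟺ bounded `j` -/

/-- The quadratic form of the Frey `c₄` on an abc-triple: `a² + ab + b² ≤ c²`. [folklore] -/
theorem quadForm_le_sq {a b c : ℕ} (habc : a + b = c) :
    (a : ℝ) ^ 2 + a * b + b ^ 2 ≤ (c : ℝ) ^ 2 := by
  have hc : (c : ℝ) = a + b := by exact_mod_cast habc.symm
  rw [hc]
  nlinarith [mul_nonneg (Nat.cast_nonneg (α := ℝ) a) (Nat.cast_nonneg (α := ℝ) b)]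

/-- The quadratic form of the Frey `c₄` on an abc-triple: `3c² ≤ 4(a² + ab + b²)`. [folklore] -/
theorem three_mul_sq_le_four_mul_quadForm {a b c : ℕ} (habc : a + b = c) :
    3 * (c : ℝ) ^ 2 ≤ 4 * ((a : ℝ) ^ 2 + a * b + b ^ 2) := by
  have hc : (c : ℝ) = a + b := by exact_mod_cast habc.symm
  rw [hc]
  nlinarith [sq_nonneg ((a : ℝ) - b)]

/-- The Frey `j`-value `2⁸(a²+ab+b²)³/(abc)²` of a triple of naturals is nonnegative. [folklore] -/
theorem freyJ_nonneg (a b c : ℕ) :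
    0 ≤ (2 : ℝ) ^ 8 * ((a : ℝ) ^ 2 + a * b + b ^ 2) ^ 3 / ((a : ℝ) * b * c) ^ 2 := by
  positivity

/-- **Compactly balanced ⟹ bounded `j`.** On the cell `κc ≤ a`, `κc ≤ b` the Frey `j`-invariant satisfies
`|j| = 2⁸(a²+ab+b²)³/(abc)² ≤ 2⁸/κ⁴` (`a²+ab+b² ≤ c²` and `(abc)² ≥ κ⁴c⁶`). [folklore] -/
theorem abs_freyJ_le_of_balanced {κ : ℝ} (hκ : 0 < κ) {a b c : ℕ} (h : IsABCTriple a b c)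
    (hκa : κ * (c : ℝ) ≤ (a : ℝ)) (hκb : κ * (c : ℝ) ≤ (b : ℝ)) :
    |(2 : ℝ) ^ 8 * ((a : ℝ) ^ 2 + a * b + b ^ 2) ^ 3 / ((a : ℝ) * b * c) ^ 2| ≤ 2 ^ 8 / κ ^ 4 := by
  obtain ⟨ha, hb, habc, -⟩ := h
  have hc : 0 < c := by omega
  have ha' : (0 : ℝ) < a := by exact_mod_cast ha
  have hb' : (0 : ℝ) < b := by exact_mod_cast hb
  have hc' : (0 : ℝ) < c := by exact_mod_cast hc
  rw [abs_of_nonneg (freyJ_nonneg a b c), div_le_div_iff₀ (by positivity) (by positivity)]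
  -- `2⁸ Q³ κ⁴ ≤ 2⁸ (abc)²`
  have hQ : (a : ℝ) ^ 2 + a * b + b ^ 2 ≤ (c : ℝ) ^ 2 := quadForm_le_sq habc
  have hQ0 : 0 ≤ (a : ℝ) ^ 2 + a * b + b ^ 2 := by positivity
  have hQ3 : ((a : ℝ) ^ 2 + a * b + b ^ 2) ^ 3 ≤ ((c : ℝ) ^ 2) ^ 3 := pow_le_pow_left₀ hQ0 hQ 3
  have hab : κ ^ 2 * (c : ℝ) ^ 2 ≤ (a : ℝ) * b := by
    have := mul_le_mul hκa hκb (by positivity) ha'.le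
    nlinarith
  have hab2 : κ ^ 4 * (c : ℝ) ^ 4 ≤ ((a : ℝ) * b) ^ 2 := by
    have := mul_le_mul hab hab (by positivity) (by positivity)
    nlinarith
  calc (2 : ℝ) ^ 8 * ((a : ℝ) ^ 2 + a * b + b ^ 2) ^ 3 * κ ^ 4
      ≤ (2 : ℝ) ^ 8 * ((c : ℝ) ^ 2) ^ 3 * κ ^ 4 := by gcongr
    _ = (2 : ℝ) ^ 8 * (c : ℝ) ^ 2 * (κ ^ 4 * (c : ℝ) ^ 4) := by ring
    _ ≤ (2 : ℝ) ^ 8 * (c : ℝ) ^ 2 * ((a : ℝ) * b) ^ 2 := by gcongr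
    _ = 2 ^ 8 * ((a : ℝ) * b * c) ^ 2 := by ring

/-- **Bounded `j` ⟹ compactly balanced.** If the Frey `j`-invariant of an abc-triple satisfies `|j| ≤ J` (`J > 0`) then
`√(108/J)·c ≤ a` and `√(108/J)·c ≤ b` (`|j| ≥ 108c⁴/(ab)²` from `4(a²+ab+b²) ≥ 3c²`, then `min·c ≥ ab ≥ √(108/J)·c²`).
[folklore] -/
theorem balanced_of_abs_freyJ_le {J : ℝ} (hJ : 0 < J) {a b c : ℕ} (h : IsABCTriple a b c)
    (hj : |(2 : ℝ) ^ 8 * ((a : ℝ) ^ 2 + a * b + b ^ 2) ^ 3 / ((a : ℝ) * b * c) ^ 2| ≤ J) :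
    Real.sqrt (108 / J) * (c : ℝ) ≤ (a : ℝ) ∧ Real.sqrt (108 / J) * (c : ℝ) ≤ (b : ℝ) := by
  obtain ⟨ha, hb, habc, -⟩ := h
  have hc : 0 < c := by omega
  have ha' : (0 : ℝ) < a := by exact_mod_cast ha
  have hb' : (0 : ℝ) < b := by exact_mod_cast hb
  have hc' : (0 : ℝ) < c := by exact_mod_cast hc
  have hac : (a : ℝ) ≤ c := by exact_mod_cast (show a ≤ c by omega)
  have hbc : (b : ℝ) ≤ c := by exact_mod_cast (show b ≤ c by omega)
  rw [abs_of_nonneg (freyJ_nonneg a b c), div_le_iff₀ (by positivity)] at hj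
  have h3 : 3 * (c : ℝ) ^ 2 ≤ 4 * ((a : ℝ) ^ 2 + a * b + b ^ 2) := three_mul_sq_le_four_mul_quadForm habc
  -- `108 c⁶ ≤ 2⁸ Q³ ≤ J (abc)²`, hence `108 c⁴ ≤ J (ab)²`
  have hQ3 : (3 * (c : ℝ) ^ 2) ^ 3 ≤ (4 * ((a : ℝ) ^ 2 + a * b + b ^ 2)) ^ 3 :=
    pow_le_pow_left₀ (by positivity) h3 3
  have h108 : 108 * (c : ℝ) ^ 4 ≤ J * ((a : ℝ) * b) ^ 2 := by
    have h1 : 108 * (c : ℝ) ^ 6 ≤ J * ((a : ℝ) * b * c) ^ 2 := by nlinarith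
    have h2 : 108 * (c : ℝ) ^ 4 * (c : ℝ) ^ 2 ≤ J * ((a : ℝ) * b) ^ 2 * (c : ℝ) ^ 2 := by nlinarith
    exact le_of_mul_le_mul_right h2 (by positivity)
  have hsq : (108 / J) * ((c : ℝ) ^ 2) ^ 2 ≤ ((a : ℝ) * b) ^ 2 := by
    rw [div_mul_eq_mul_div, div_le_iff₀ hJ]; nlinarith
  -- take square roots: `√(108/J)·c² ≤ ab`
  have hs : Real.sqrt (108 / J) * (c : ℝ) ^ 2 ≤ (a : ℝ) * b := by
    have := Real.sqrt_le_sqrt hsq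
    rwa [Real.sqrt_mul (by positivity), Real.sqrt_sq (by positivity), Real.sqrt_sq (by positivity)] at this
  constructor
  · -- `√(108/J)·c·c ≤ ab ≤ a·c`
    have : Real.sqrt (108 / J) * (c : ℝ) * c ≤ (a : ℝ) * c := by nlinarith [mul_le_mul_of_nonneg_left hbc ha'.le]
    exact le_of_mul_le_mul_right this hc'
  · have : Real.sqrt (108 / J) * (c : ℝ) * c ≤ (b : ℝ) * c := by nlinarith [mul_le_mul_of_nonneg_left hac hb'.le]
    exact le_of_mul_le_mul_right this hc'

/-- **`H ↔` abc on bounded-`j` Frey fibres.** abc with exponent `1+ε` on every compactly balanced cell (the hypothesis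
`H` of the crux) is EQUIVALENT to abc with exponent `1+ε` on every family of abc-triples whose Frey curve has bounded
`j`-invariant (`|2⁸(a²+ab+b²)³/(abc)²| ≤ J`, the value of `exists_minimal_frey_model_j` / `freyCurve_j`): compactly
balanced in `P¹∖{0,1,∞}` is compactly bounded in `X(1)` at the archimedean place. This is the exact sense in which the
crux `CompactBalanceTransfer` is the degree-1 shadow of MochizukiGenEll2010 Thm 2.1. [folklore] -/
theorem balancedABC_iff_boundedJ :
    (∀ κ : ℝ, 0 < κ → ∀ ε : ℝ, 0 < ε → ∃ C : ℝ, ∀ a b c : ℕ, IsABCTriple a b c →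
        κ * (c : ℝ) ≤ (a : ℝ) → κ * (c : ℝ) ≤ (b : ℝ) → (c : ℝ) < C * ((rad a b c : ℕ) : ℝ) ^ (1 + ε)) ↔
    (∀ J : ℝ, ∀ ε : ℝ, 0 < ε → ∃ C : ℝ, ∀ a b c : ℕ, IsABCTriple a b c →
        |(2 : ℝ) ^ 8 * ((a : ℝ) ^ 2 + a * b + b ^ 2) ^ 3 / ((a : ℝ) * b * c) ^ 2| ≤ J →
          (c : ℝ) < C * ((rad a b c : ℕ) : ℝ) ^ (1 + ε)) := by
  constructor
  · intro hH J ε hε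
    set J' : ℝ := max J 1 with hJ'
    have hJ'0 : 0 < J' := lt_of_lt_of_le one_pos (le_max_right _ _)
    obtain ⟨C, hC⟩ := hH (Real.sqrt (108 / J')) (Real.sqrt_pos.mpr (by positivity)) ε hε
    refine ⟨C, fun a b c h hj => ?_⟩
    obtain ⟨h₁, h₂⟩ := balanced_of_abs_freyJ_le hJ'0 h (hj.trans (le_max_left _ _))
    exact hC a b c h h₁ h₂
  · intro hJ κ hκ ε hε
    obtain ⟨C, hC⟩ := hJ (2 ^ 8 / κ ^ 4) ε hε
    exact ⟨C, fun a b c h h₁ h₂ => hC a b c h (abs_freyJ_le_of_balanced hκ h h₁ h₂)⟩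

/-- **The crux in bounded-`j` currency.** `CompactBalanceTransfer` is EQUIVALENT to: abc with exponent `1+ε` on every
bounded-`j` family of Frey fibres (`|2⁸(a²+ab+b²)³/(abc)²| ≤ J`, constant depending on `J, ε`) implies abc — i.e. to
"abc for the compactly bounded (at the archimedean place) subsets of `P¹∖{0,1,∞}` in degree 1 ⟹ abc", the `d = 1`
case that MochizukiGenEll2010 Thm 2.1 does not cover. [folklore] -/
theorem compactBalanceTransfer_iff_boundedJTransfer :
    CompactBalanceTransfer ↔
      ((∀ J : ℝ, ∀ ε : ℝ, 0 < ε → ∃ C : ℝ, ∀ a b c : ℕ, IsABCTriple a b c →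
          |(2 : ℝ) ^ 8 * ((a : ℝ) ^ 2 + a * b + b ^ 2) ^ 3 / ((a : ℝ) * b * c) ^ 2| ≤ J →
            (c : ℝ) < C * ((rad a b c : ℕ) : ℝ) ^ (1 + ε)) → _root_.ABC) := by
  unfold CompactBalanceTransfer
  rw [balancedABC_iff_boundedJ]

/-! ## Bounded-`j` Szpiro and the crux -/

/-- Sixth roots: `c⁶ ≤ K·R^(6+6ε)` with `K ≥ 0`, `R ≥ 0` gives `c ≤ K^(1/6)·R^(1+ε)` (no sign condition on `c`). [folklore] -/
theorem le_rpow_sixth_of_pow_six_le {c K R ε : ℝ} (hK : 0 ≤ K) (hR : 0 ≤ R)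
    (h : c ^ 6 ≤ K * R ^ (6 + 6 * ε)) : c ≤ K ^ (1 / 6 : ℝ) * R ^ (1 + ε) := by
  have h6 : (K ^ (1 / 6 : ℝ) * R ^ (1 + ε)) ^ 6 = K * R ^ (6 + 6 * ε) := by
    rw [mul_pow, ← Real.rpow_natCast (K ^ (1 / 6 : ℝ)) 6, ← Real.rpow_mul hK,
      ← Real.rpow_natCast (R ^ (1 + ε)) 6, ← Real.rpow_mul hR]
    norm_num
    left; ring_nf
  exact le_of_pow_le_pow_left₀ (by norm_num) (by positivity) (h.trans_eq h6.symm)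

/-- **Bounded-`j` Szpiro ⟹ `H`.** Szpiro's `6+ε` for all elliptic curves over `ℚ` with `|j| ≤ J` (for every `J`, with a
constant depending on `J` and `ε` — the crux-strategist's `BoundedJSzpiro`, STRATEGY-CENSUS s1 §6.2, written out)
implies abc with exponent `1+ε` on every compactly balanced cell: on the cell `κc ≤ a, b` the global minimal Frey
model has `|j| ≤ 2⁸/κ⁴` (`exists_minimal_frey_model_j`, `abs_freyJ_le_of_balanced`), so
`κ⁴c⁶ ≤ (abc)² ≤ 2⁸|Δ_min| ≤ 2⁸·C·(2¹⁰ rad)^(6+6ε)`. [folklore] -/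
theorem balancedABC_of_boundedJSzpiro :
    (∀ J : ℝ, ∀ ε : ℝ, 0 < ε → ∃ C : ℝ, ∀ (W : WeierstrassCurve ℚ) [W.IsElliptic],
        |((WeierstrassCurve.j W : ℚ) : ℝ)| ≤ J →
          (W.minimalDiscriminantNorm ℤ : ℝ) ≤ C * (W.conductorNorm ℤ : ℝ) ^ (6 + ε)) →
      ∀ κ : ℝ, 0 < κ → ∀ ε : ℝ, 0 < ε → ∃ C : ℝ, ∀ a b c : ℕ, IsABCTriple a b c →
        κ * (c : ℝ) ≤ (a : ℝ) → κ * (c : ℝ) ≤ (b : ℝ) → (c : ℝ) < C * ((rad a b c : ℕ) : ℝ) ^ (1 + ε) := by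
  intro hBJ κ hκ ε hε
  obtain ⟨C₁, hC₁⟩ := hBJ (2 ^ 8 / κ ^ 4) (6 * ε) (by positivity)
  set C : ℝ := max C₁ 1 with hCdef
  have hC0 : 0 ≤ C := le_trans zero_le_one (le_max_right _ _)
  -- `(abc)² ≤ M · rad^(6+6ε)` on the cell, `M := 2⁸ C (2¹⁰)^(6+6ε)`; then `c⁶ ≤ (M/κ⁴) rad^(6+6ε)`
  set M : ℝ := 2 ^ 8 * C * ((2 : ℝ) ^ 10) ^ (6 + 6 * ε) with hMdef
  have hM0 : 0 ≤ M := by positivity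
  refine ⟨(M / κ ^ 4) ^ (1 / 6 : ℝ) + 1, fun a b c h hκa hκb => ?_⟩
  obtain ⟨W₀, hE, hmin, hN, hdisc, hj⟩ := exists_minimal_frey_model_j h
  have htriple := h
  obtain ⟨ha, hb, habc, -⟩ := h
  have hc : 0 < c := by omega
  have ha' : (0 : ℝ) < a := by exact_mod_cast ha
  have hc' : (0 : ℝ) < c := by exact_mod_cast hc
  -- the `j`-bound on the cell, transported to `W₀ ⊗ ℚ`
  have hjR : |(((W₀.baseChange ℚ).j : ℚ) : ℝ)| ≤ 2 ^ 8 / κ ^ 4 := by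
    have hcast : (((W₀.baseChange ℚ).j : ℚ) : ℝ) =
        (2 : ℝ) ^ 8 * ((a : ℝ) ^ 2 + a * b + b ^ 2) ^ 3 / ((a : ℝ) * b * c) ^ 2 := by
      rw [hj]; push_cast; ring
    rw [hcast]
    exact abs_freyJ_le_of_balanced hκ htriple hκa hκb
  have key := hC₁ (W₀.baseChange ℚ) hjR
  rw [WeierstrassCurve.minimalDiscriminantNorm_eq_natAbs_holds W₀
      (WeierstrassCurve.Δ_ne_zero_of_isElliptic_baseChange_int W₀) hmin,
    Nat.cast_natAbs, Int.cast_abs] at key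
  set N : ℝ := (((W₀.baseChange ℚ).conductorNorm ℤ : ℕ) : ℝ) with hNdef
  set R : ℝ := ((rad a b c : ℕ) : ℝ) with hRdef
  have hN0 : 0 ≤ N := by positivity
  have hR1 : 1 ≤ R := by
    rw [hRdef, rad_def]; exact_mod_cast Nat.radical_pos _
  have hR0 : 0 ≤ R := zero_le_one.trans hR1
  have hε6 : (0 : ℝ) ≤ 6 + 6 * ε := by positivity
  have h1 : |(W₀.Δ : ℝ)| ≤ C * N ^ (6 + 6 * ε) :=
    key.trans (mul_le_mul_of_nonneg_right (le_max_left _ _) (by positivity))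
  have h2 : N ≤ 2 ^ 10 * R := by
    have := Nat.le_of_dvd (mul_pos (by positivity) (by rw [rad_def]; exact Nat.radical_pos _)) hN
    rw [hNdef, hRdef]; exact_mod_cast this
  have h3 : ((a * b * c : ℕ) : ℝ) ^ 2 ≤ 2 ^ 8 * |(W₀.Δ : ℝ)| := by exact_mod_cast hdisc
  have h4 : ((a * b * c : ℕ) : ℝ) ^ 2 ≤ M * R ^ (6 + 6 * ε) :=
    calc ((a * b * c : ℕ) : ℝ) ^ 2 ≤ 2 ^ 8 * |(W₀.Δ : ℝ)| := h3
      _ ≤ 2 ^ 8 * (C * N ^ (6 + 6 * ε)) := by linarith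
      _ ≤ 2 ^ 8 * (C * (2 ^ 10 * R) ^ (6 + 6 * ε)) := by gcongr
      _ = M * R ^ (6 + 6 * ε) := by
          rw [hMdef, Real.mul_rpow (by positivity) hR0]; ring
  -- balance: `κ⁴ c⁶ ≤ (abc)²`
  have hab : κ ^ 2 * (c : ℝ) ^ 2 ≤ (a : ℝ) * b := by
    have := mul_le_mul hκa hκb (by positivity) ha'.le
    nlinarith
  have hbal : κ ^ 4 * (c : ℝ) ^ 6 ≤ ((a * b * c : ℕ) : ℝ) ^ 2 := by
    have hab2 : κ ^ 4 * (c : ℝ) ^ 4 ≤ ((a : ℝ) * b) ^ 2 := by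
      have := mul_le_mul hab hab (by positivity) (by positivity)
      nlinarith
    push_cast
    nlinarith [mul_le_mul_of_nonneg_right hab2 (sq_nonneg (c : ℝ))]
  have h5 : (c : ℝ) ^ 6 ≤ M / κ ^ 4 * R ^ (6 + 6 * ε) := by
    rw [div_mul_eq_mul_div, le_div_iff₀ (by positivity)]
    nlinarith
  have h6 : (c : ℝ) ≤ (M / κ ^ 4) ^ (1 / 6 : ℝ) * R ^ (1 + ε) :=
    le_rpow_sixth_of_pow_six_le (by positivity) hR0 h5
  have hR' : 0 < R ^ (1 + ε) := Real.rpow_pos_of_pos (lt_of_lt_of_le one_pos hR1) _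
  calc (c : ℝ) ≤ (M / κ ^ 4) ^ (1 / 6 : ℝ) * R ^ (1 + ε) := h6
    _ < ((M / κ ^ 4) ^ (1 / 6 : ℝ) + 1) * R ^ (1 + ε) := by nlinarith

/-- `SzpiroConjecture` (all `E/ℚ`) implies its bounded-`j` restriction `BJ` (ignore the `j`-bound). [folklore] -/
theorem boundedJSzpiro_of_szpiro (hS : SzpiroConjecture) :
    ∀ J : ℝ, ∀ ε : ℝ, 0 < ε → ∃ C : ℝ, ∀ (W : WeierstrassCurve ℚ) [W.IsElliptic],
        |((WeierstrassCurve.j W : ℚ) : ℝ)| ≤ J →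
          (W.minimalDiscriminantNorm ℤ : ℝ) ≤ C * (W.conductorNorm ℤ : ℝ) ^ (6 + ε) := by
  intro _J ε hε
  obtain ⟨C, hC⟩ := hS ε hε
  exact ⟨C, fun W _ _ => hC W⟩

/-- **Strength certificate, bounded-`j` currency**: `CompactBalanceTransfer → BJ → ABC`. Any proof of the crux
stmt-ABC-1725 proves the H-free partner `BJToABC` of the crux-strategist's route move R3 ("bounded-`j` Szpiro implies
abc"), itself at least "Szpiro's conjecture implies abc" (`boundedJSzpiro_of_szpiro`; cf.
`Negative.abc_of_szpiro_of_compactBalanceTransfer`, p97877). [folklore] -/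
theorem abc_of_boundedJSzpiro_of_compactBalanceTransfer (hT : CompactBalanceTransfer)
    (hBJ : ∀ J : ℝ, ∀ ε : ℝ, 0 < ε → ∃ C : ℝ, ∀ (W : WeierstrassCurve ℚ) [W.IsElliptic],
        |((WeierstrassCurve.j W : ℚ) : ℝ)| ≤ J →
          (W.minimalDiscriminantNorm ℤ : ℝ) ≤ C * (W.conductorNorm ℤ : ℝ) ^ (6 + ε)) :
    _root_.ABC :=
  hT (balancedABC_of_boundedJSzpiro hBJ)

end Summit.ABC.ABC.Theorems.CompactBalanceTransfer.BoundedJ
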